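import Summits.Parity.BatemanHorn.Theorems.SoloInformedPairWindowLogSq
import Summits.Parity.BatemanHorn.Theorems.SoloInformedTwinWindowForms
import Summits.Parity.BatemanHorn.Theorems.SoloInformedTwinUnbalanced
import Summits.Parity.BatemanHorn.Theorems.SoloInformedTwinFarTailChowla

/-!
# SoloInformedTwinWindowDFI — (F) in the kernel for `x^{5/11} < z`: the balanced twin window is
# `o(x)` past `x`; the kernel equivalence `HL₂ ⟺ balanced far tail` HYPOTHESIS-FREE

Solo unit `solo-Parity-informed` (ideation tier, informed mode), session 82; `paper.md` §20
((F)-kernel project), `SHARPEST-STATEMENT.md` §2 Theorem F, CLAIMS C172–C173.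

Until now the kernel equivalence `twinPrime_iff_balancedFarTail_rpow_all` (C125) carried ONE
prose premise `hW` = (F): the balanced window `x^{1-η} < e₁e₂ ≤ x^{1+θ}` of the located twin
Möbius sum is `o(x)`.  Here (F) is PROVED in the kernel in the Duke–Friedlander–Iwaniec range: for
`5/11 < σ < 1/2` there is `c = c(σ) > 0` (`c = (11σ-5)/768`) such that for all `0 < θ, η ≤ c`

  `twinBalancedWindowSum x ⌊x^{1-η}⌋ ⌊x^σ⌋ ⌊x^{1+θ}⌋ = o(x)`            (`twinBalancedWindowSum_isLittleO_DFI`)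

— from the Literature package `LinearPair*` ([DFI97] bilinear forms in Kloosterman fractions,
exact CRT count, Erdős–Turán, Siegel–Walfisz main term; PROVED there for the weight `μlog ⊗ μlog`)
extended to the twin weight `μ(e₁)μ(e₂)log²(e₁e₂)` (`PairWindow.window_pair_sum_logsq_isLittleO`,
C170) and transported to the kernel objects (`PairWindow.twinBalancedWindowSum_eq_forms`, C171).

Consequently (`twinPrime_iff_balancedFarTail_DFI`, C173), with NO hypothesis: for `5/11 < σ < 1/2`
and all `0 < θ, η ≤ c(σ)`,

  `π₂(x) ~ 2C₂ x/log²x  ⟺  ∑_{e₁,e₂ > x^σ, e₁e₂ > x^{1+θ}} μ(e₁)μ(e₂) log²(e₁e₂) N(e₁,e₂;x) = o(x)`,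

i.e. the Hardy–Littlewood prime-pair asymptotic is equivalent to cancellation in the balanced
Möbius pairs with product PAST `x^{1+θ}` alone (cofactors `m₁m₂ < x^{1-θ}`): the kernel wall now
stands beyond `x`.  The summit verdict (NO PATH: the far tail is pair-Chowla / the parity wall) is
unchanged; what moved is that the last analytic premise short of the wall is discharged.
-/

namespace Summit.Parity.BatemanHorn.Theorems

open Finset Filter Asymptotics ArithmeticFunction
open scoped ArithmeticFunction.Moebius
open Literature.NumberTheory.Sieve

/-- The box/count-length side conditions of `window_pair_sum_logsq_isLittleO` for the kernel's
box `e ≤ x + 2` and count lengths `⌈x/2⌉`, `⌊x/2⌋`. -/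
theorem PairWindow.eventually_twin_box {σ : ℝ} (hσ : 0 < σ) (X : ℕ → ℕ) (hX : ∀ x, X x ≤ x) :
    ∀ᶠ x : ℕ in atTop, (x : ℝ) ^ (1 - σ / 2) ≤ ((fun x : ℕ => x + 2) x : ℕ) ∧
      (((fun x : ℕ => x + 2) x : ℕ) : ℝ) ≤ (x : ℝ) ^ 2 ∧ 0 ≤ X x ∧ X x ≤ x := by
  filter_upwards [eventually_ge_atTop 2] with x hx
  have hx1 : (1 : ℝ) ≤ x := by exact_mod_cast (show 1 ≤ x by omega)
  have hx2 : (2 : ℝ) ≤ x := by exact_mod_cast hx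
  refine ⟨?_, ?_, Nat.zero_le _, hX x⟩
  · calc (x : ℝ) ^ (1 - σ / 2) ≤ (x : ℝ) ^ (1 : ℝ) :=
          Real.rpow_le_rpow_of_exponent_le hx1 (by linarith)
      _ ≤ ((x + 2 : ℕ) : ℝ) := by rw [Real.rpow_one]; push_cast; linarith
  · push_cast; nlinarith

/-- **(F) in the kernel (DFI range).**  For `5/11 < σ < 1/2` there is `c > 0` such that for all
`0 < θ, η ≤ c`:  `twinBalancedWindowSum x ⌊x^{1-η}⌋ ⌊x^σ⌋ ⌊x^{1+θ}⌋ = o(x)` — the balanced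
divisor pairs `e₁, e₂ > x^σ` with `x^{1-η} < e₁e₂ ≤ x^{1+θ}` contribute `o(x)` to the located
twin sum.  [DFI97, Thm 2] via `Literature.NumberTheory.Sieve.LinearPair*`. -/
theorem twinBalancedWindowSum_isLittleO_DFI {σ : ℝ} (hσ : 5 / 11 < σ) (hσ' : σ < 1 / 2) :
    ∃ c : ℝ, 0 < c ∧ ∀ θ η : ℝ, 0 < θ → θ ≤ c → 0 < η → η ≤ c →
      (fun x => twinBalancedWindowSum x (rpowCut η x) (balanceCut (1 / 2 - σ) x)
        (productLevel θ x)) =o[atTop] fun x : ℕ => (x : ℝ) := by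
  have hσ0 : 0 < σ := by linarith
  have hcA : IsCoprime ((2 : ℕ) : ℤ) (-1) := isCoprime_one_right.neg_right
  have hcB : IsCoprime ((2 : ℕ) : ℤ) 1 := isCoprime_one_right
  have hcC : IsCoprime ((1 : ℕ) : ℤ) 0 := by
    rw [Nat.cast_one]; exact isCoprime_one_left
  have hcD : IsCoprime ((1 : ℕ) : ℤ) 1 := isCoprime_one_right
  have hΔ₁ : ((2 : ℕ) : ℤ) * (-1) - ((2 : ℕ) : ℤ) * 1 ≠ 0 := by norm_num
  have hΔ₂ : ((1 : ℕ) : ℤ) * 0 - ((1 : ℕ) : ℤ) * 1 ≠ 0 := by norm_num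
  obtain ⟨c₁, hc₁, h₁⟩ := PairWindow.window_pair_sum_logsq_isLittleO (q₀ := 2) (q₁ := 2)
    (a₀ := -1) (a₁ := 1) two_pos two_pos hcA hcB hΔ₁ hσ hσ'
  obtain ⟨c₂, hc₂, h₂⟩ := PairWindow.window_pair_sum_logsq_isLittleO (q₀ := 1) (q₁ := 1)
    (a₀ := 0) (a₁ := 1) one_pos one_pos hcC hcD hΔ₂ hσ hσ'
  refine ⟨min c₁ c₂, lt_min hc₁ hc₂, fun θ η hθ hθc hη hηc => ?_⟩
  have H₁ := h₁ θ η hθ (hθc.trans (min_le_left _ _)) hη (hηc.trans (min_le_left _ _)) 0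
    (fun x : ℕ => x + 2) (fun x : ℕ => (x + 1) / 2)
    (PairWindow.eventually_twin_box hσ0 _ fun x => by omega)
  have H₂ := h₂ θ η hθ (hθc.trans (min_le_right _ _)) hη (hηc.trans (min_le_right _ _)) 0
    (fun x : ℕ => x + 2) (fun x : ℕ => x / 2)
    (PairWindow.eventually_twin_box hσ0 _ fun x => Nat.div_le_self x 2)
  refine (H₁.add H₂).congr' (Eventually.of_forall fun x => ?_) EventuallyEq.rfl
  exact (PairWindow.twinBalancedWindowSum_eq_forms σ θ η x).symm

/-- **HL₂ ⟺ balanced far tail, HYPOTHESIS-FREE (the kernel wall past `x`).**  For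
`5/11 < σ < 1/2` there is `c = c(σ) > 0` such that for all `0 < θ, η ≤ c`:

  `π₂(x) ~ 2C₂ x/log²x  ⟺  ∑_{e₁,e₂ > x^σ, e₁e₂ > x^{1+θ}} 𝟙[e₁e₂ > x^{1-η}] μ(e₁)μ(e₂)
                              log²(e₁e₂) N(e₁,e₂;x) = o(x)`,

`N(e₁,e₂;x) = #{n ≤ x odd : e₁ ∣ n, e₂ ∣ n+2} + #{m ≤ x/2 : e₁ ∣ m, e₂ ∣ m+1}`.  Both analytic
inputs of paper.md §20 are now kernel theorems: (F′) = `twinUnbalancedSum_isLittleO` (C124;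
Bombieri–Vinogradov for `μ`, BFI bilinear) and (F) = `twinBalancedWindowSum_isLittleO_DFI`
(DFI bilinear Kloosterman).  What remains on the right is pair-Chowla with balanced cofactors
`m₁m₂ < x^{1-θ}` — the parity wall itself. -/
theorem twinPrime_iff_balancedFarTail_DFI {σ : ℝ} (hσ : 5 / 11 < σ) (hσ' : σ < 1 / 2) :
    ∃ c : ℝ, 0 < c ∧ ∀ θ η : ℝ, 0 < θ → θ ≤ c → 0 < η → η ≤ c →
      ((fun x : ℕ => (twinPrimeCount x : ℝ)) ~[atTop]
          (fun x : ℕ => 2 * twinPrimeConst * x / Real.log x ^ 2) ↔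
        (fun x => twinBalancedFarSum x (rpowCut η x) (balanceCut (1 / 2 - σ) x)
          (productLevel θ x)) =o[atTop] fun x : ℕ => (x : ℝ)) := by
  obtain ⟨c₀, hc₀, hW⟩ := twinBalancedWindowSum_isLittleO_DFI hσ hσ'
  refine ⟨min c₀ ((1 / 2 - σ) / 2), lt_min hc₀ (by linarith), fun θ η hθ hθc hη hηc => ?_⟩
  have hθc' : θ ≤ c₀ := hθc.trans (min_le_left _ _)
  have hηc' : η ≤ c₀ := hηc.trans (min_le_left _ _)
  have hη₀ : η < 1 / 2 - σ := by
    have := hηc.trans (min_le_right _ _)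
    linarith
  exact twinPrime_iff_balancedFarTail_rpow_all hη hη₀ (by linarith) (hW θ η hθ hθc' hη hηc')

/-- **Hardy–Littlewood from uniform dilated pair-Chowla, hypothesis-free frame (DFI range).**
For `5/11 < σ < 1/2` there is `c > 0` such that for all `0 < θ, η ≤ c`: if for every `δ > 0`,
eventually every balanced cofactor pair `(m₁, m₂)` (`mᵢ ≤ (x+2)/(⌊x^σ⌋+1)`,
`(⌊x^{1+θ}⌋+1) m₁m₂ ≤ x(x+2)`) has `|twinCofactorTerm| ≤ δ x/(m₁m₂ (1+log(x+2))²)`, then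
`π₂(x) ~ 2C₂ x/log²x`.  ((F′) and (F) discharged; only the cofactor bound `hC` — dilated
pair-Chowla, the parity wall — is assumed.) -/
theorem hardyLittlewood_of_uniform_cofactor_bound_DFI {σ : ℝ} (hσ : 5 / 11 < σ)
    (hσ' : σ < 1 / 2) :
    ∃ c : ℝ, 0 < c ∧ ∀ θ η : ℝ, 0 < θ → θ ≤ c → 0 < η → η ≤ c →
      (∀ δ : ℝ, 0 < δ → ∀ᶠ x : ℕ in atTop,
        ∀ m₁ ∈ Icc 1 (x / (balanceCut (1 / 2 - σ) x + 1)),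
          ∀ m₂ ∈ Icc 1 ((x + 2) / (balanceCut (1 / 2 - σ) x + 1)),
          (productLevel θ x + 1) * (m₁ * m₂) ≤ x * (x + 2) →
          |twinCofactorTerm x (rpowCut η x) (balanceCut (1 / 2 - σ) x) (productLevel θ x) m₁ m₂|
            ≤ δ * x / (((m₁ : ℝ) * m₂) * (1 + Real.log ((x : ℝ) + 2)) ^ 2)) →
      (fun x : ℕ => (twinPrimeCount x : ℝ)) ~[atTop]
        fun x : ℕ => 2 * twinPrimeConst * x / Real.log x ^ 2 := by
  obtain ⟨c₀, hc₀, hW⟩ := twinBalancedWindowSum_isLittleO_DFI hσ hσ'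
  refine ⟨min c₀ ((1 / 2 - σ) / 2), lt_min hc₀ (by linarith), fun θ η hθ hθc hη hηc hC => ?_⟩
  have hθc' : θ ≤ c₀ := hθc.trans (min_le_left _ _)
  have hηc' : η ≤ c₀ := hηc.trans (min_le_left _ _)
  have hη₀ : η < 1 / 2 - σ := by
    have := hηc.trans (min_le_right _ _)
    linarith
  exact hardyLittlewood_of_uniform_cofactor_bound_rpow hη (by linarith)
    (twinUnbalancedSum_isLittleO hη hη₀ (by linarith)) (hW θ η hθ hθc' hη hηc') hC

/-- **Tier 1, one-sided, per dilation ⟹ the twin prime conjecture — hypothesis-free frame (DFI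
range).**  For `5/11 < σ < 1/2` there is `c > 0` such that for all `0 < θ, η ≤ c`: if for some
fixed `0 ≤ δ < 4C₂` and infinitely many `x` EVERY dilated correlation on the effective range
(`m₁ ≤ x/(⌊x^σ⌋+1)`, `m₂ ≤ (x+2)/(⌊x^σ⌋+1)`, `(⌊x^{1+θ}⌋+1) m₁m₂ ≤ x(x+2)`) has
`C(m₁,m₂) ≥ -δx/(m₁m₂(1+log(x+2))²)`, then there are infinitely many twin primes.  ((F′), (F)
discharged.) -/
theorem twinPrimeConjecture_of_frequently_cofactor_lower_DFI {σ : ℝ} (hσ : 5 / 11 < σ)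
    (hσ' : σ < 1 / 2) :
    ∃ c : ℝ, 0 < c ∧ ∀ θ η : ℝ, 0 < θ → θ ≤ c → 0 < η → η ≤ c →
      (∃ δ : ℝ, 0 ≤ δ ∧ δ < 4 * twinPrimeConst ∧ ∃ᶠ x : ℕ in atTop,
        ∀ m₁ ∈ Icc 1 (x / (balanceCut (1 / 2 - σ) x + 1)),
          ∀ m₂ ∈ Icc 1 ((x + 2) / (balanceCut (1 / 2 - σ) x + 1)),
          (productLevel θ x + 1) * (m₁ * m₂) ≤ x * (x + 2) →
          -(δ * x / (((m₁ : ℝ) * m₂) * (1 + Real.log ((x : ℝ) + 2)) ^ 2))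
            ≤ twinCofactorTerm x (rpowCut η x) (balanceCut (1 / 2 - σ) x) (productLevel θ x)
              m₁ m₂) →
      TwinPrimeConjecture := by
  obtain ⟨c₀, hc₀, hW⟩ := twinBalancedWindowSum_isLittleO_DFI hσ hσ'
  refine ⟨min c₀ ((1 / 2 - σ) / 2), lt_min hc₀ (by linarith), fun θ η hθ hθc hη hηc h => ?_⟩
  have hθc' : θ ≤ c₀ := hθc.trans (min_le_left _ _)
  have hηc' : η ≤ c₀ := hηc.trans (min_le_left _ _)
  have hη₀ : η < 1 / 2 - σ := by
    have := hηc.trans (min_le_right _ _)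
    linarith
  exact twinPrimeConjecture_of_frequently_cofactor_lower (z := balanceCut (1 / 2 - σ))
    (Y := productLevel θ) hη (by linarith) (twinUnbalancedSum_isLittleO hη hη₀ (by linarith))
    (hW θ η hθ hθc' hη hηc') h

end Summit.Parity.BatemanHorn.Theorems
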